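import Mathlib
import Summits.ResolutionOfSingularities.ResolutionOfSingularities.Theorems.RadicialJungCleanModelsDimOfLocalMonomialization
import Summits.ResolutionOfSingularities.ResolutionOfSingularities.Theorems.RadicialJungCleanModelsCleanLU3CompositeCdiv
import Summits.ResolutionOfSingularities.ResolutionOfSingularities.Theorems.RadicialJungCleanModelsCcurvePersistPrelims
import Summits.ResolutionOfSingularities.ResolutionOfSingularities.Theorems.RadicialJungCleanModelsLens5KbarCossartPackaging
import Literature.AlgebraicGeometry.Resolution.CompleteLocalDomainNormalization
import HarnessLib

/-!
# Route `RadicialJung`, crux `CleanModels` (stmt-ResolutionOfSingularities-15917), skeleton `Cruxes/CleanModels/Lines/Sketch.lean` rev 35: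
# the graded zero-dimensional local input `CleanLUZeroDim_d` in the SMALL dimensions `d = 0, 1, 2` — discharged

Explicit-unit seat `decomp-res-hand-2` g7 (share = stubs 5–7, strategy «structural»).  OURS, def-free, route-independent (no `Theses` import);
nothing here proves resolution of singularities in characteristic `p`.

The all-dimension node ✓ `GradedAssembly.cleanModels_of_cleanLUZeroDim_of_cleanTwoModelPatching_allDim` and the support-item reduction ✓
`cleanAlongValuation4_of_cleanLUZeroDim` (this seat) consume the local input of the crux in the graded shape `CleanLUZeroDim_d` (clean LU of the
`K^p`-line of `g₀` at zero-dimensional valuation rings with a `d`-dimensional regular finitely generated centre).  For the census of the support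
item stmt-18006 (`…CleanAlongValuation4OfInputs.lean`) the small dimensions are needed as THEOREMS:

* `cleanLUZeroDim_zero` — `d = 0`: the centre is a field, so `A_{𝔪_O ∩ A} = K` and `g₀ ∉ K^p` itself is a residually non-`p`-th-power unit;
* `localMonomialization_one`, `valuation_discrete_of_dimOne_centre`, `cleanLUZeroDim_one` — `d = 1`: the centre is a DVR (✓
  `isDiscreteValuationRing_of_isRegularLocalRing_of_ringKrullDim_eq_one`), every element of the model is `unit × ϖⁿ` there (`hMono_1`), and the
  valuation is discrete of rank one (so the class-(B) input `hND_1` is VACUOUS); then hand-2 g3's ✓ `cleanLUZeroDim_dim_of_localMonomialization 1`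
  (best-approximation half, Kuhlmann's Abhyankar exit and the arc class PROVED in every dimension);
* `cleanLUZeroDim_two` — `d = 2`: the landed ✓ `stub_cleanLU2` (F-75c, Giraud; lead res-B-lead-1 g5) at the graded shape.
-/

noncomputable section

set_option linter.dupNamespace false -- mandated namespace of this single-conjunct summit

open IsLocalRing
open Literature.AlgebraicGeometry.Resolution Literature.AlgebraicGeometry.Motives

namespace Summit.ResolutionOfSingularities.ResolutionOfSingularities.Theorems.RadicialJung.CleanModels

/-! ## §1 Dimension `0`: the centre is the generic point -/

/-- **`CleanLUZeroDim_0`**: if the centre of `O` on the model `A` is `0`-dimensional (a field), then `A_{𝔪_O ∩ A} = K` and `g₀ ∉ K^p`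
itself is a unit of regular type (i): `g₀ - c^p ≠ 0` for every `c`.  Representative `c = (0, 1, 0, …)`. [folklore] -/
theorem cleanLUZeroDim_zero : ∀ (p : ℕ), p.Prime →
    ∀ (k : Type) [Field k] [CharP k p] (K : Type) [Field K] [Algebra k K]
    (O : ValuationSubring K) (A : Subalgebra k K), A.toSubring ≤ O.toSubring → A.FG → IsFractionRing A K →
    ringKrullDim A ≤ (((0 : ℕ) : ℕ) : WithBot ℕ∞) → IsRegularLocalRing (locAtCentre A.toSubring O) →
    ringKrullDim (locAtCentre A.toSubring O) = (((0 : ℕ) : ℕ) : WithBot ℕ∞) →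
    (∀ (T : Subring K) (hT : T ≤ O.toSubring), A.toSubring ≤ T → (subringCentre T O hT).IsMaximal) →
    ∀ g₀ : K, (∀ c : K, c ^ p ≠ g₀) →
    ∃ (A' : Subalgebra k K), A'.toSubring ≤ O.toSubring ∧ A ≤ A' ∧ A'.FG ∧
    ∃ (_ : IsRegularLocalRing (locAtCentre A'.toSubring O)) (c : Fin p → K), (∃ j : Fin p, (j : ℕ) ≠ 0 ∧ c j ≠ 0) ∧
    ((∃ (d m : ℕ) (hmd : m ≤ d) (t : Fin d → ↥(locAtCentre A'.toSubring O)) (a : Fin m → ℕ) (u : ↥(locAtCentre A'.toSubring O)), IsUnit u ∧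
    Ideal.span (Set.range t) = IsLocalRing.maximalIdeal ↥(locAtCentre A'.toSubring O) ∧
    ringKrullDim ↥(locAtCentre A'.toSubring O) = (d : WithBot ℕ∞) ∧ 0 < m ∧ (∀ i, ¬ p ∣ a i) ∧
    (∑ j : Fin p, c j ^ p * g₀ ^ (j : ℕ)) = (u : K) * ∏ i : Fin m, ((t (Fin.castLE hmd i) : ↥(locAtCentre A'.toSubring O)) : K) ^ (a i)) ∨
    (∃ u : ↥(locAtCentre A'.toSubring O), IsUnit u ∧ (∑ j : Fin p, c j ^ p * g₀ ^ (j : ℕ)) = (u : K) ∧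
    ∀ c' : ↥(locAtCentre A'.toSubring O), u - c' ^ p ∉ IsLocalRing.maximalIdeal ↥(locAtCentre A'.toSubring O)) ∨
    (∃ s c' : ↥(locAtCentre A'.toSubring O), (∑ j : Fin p, c j ^ p * g₀ ^ (j : ℕ)) = (s : K) ∧
    s - c' ^ p ∈ IsLocalRing.maximalIdeal ↥(locAtCentre A'.toSubring O) ∧
    s - c' ^ p ∉ IsLocalRing.maximalIdeal ↥(locAtCentre A'.toSubring O) ^ 2)) := by
  intro p hp k _ _ K _ _ O A hAO hAfg hfrac _hdimA hreg hdim _hzd g₀ hg₀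
  classical
  haveI : Fact p.Prime := ⟨hp⟩
  haveI := hreg
  set R : Subring K := locAtCentre A.toSubring O with hRdef
  have hRO : R ≤ O.toSubring := locAtCentre_le hAO
  -- a regular local ring of dimension `0` is a field: its maximal ideal is generated by `0` elements
  have hdim0 : ringKrullDim R = (0 : ℕ) := hdim
  have hfield : IsField R := by
    simpa [← (isRegularLocalRing_iff R).mp hreg, Submodule.spanFinrank_eq_zero_iff_eq_bot,
      IsNoetherian.noetherian, ← isField_iff_maximalIdeal_eq] using hdim0
  have hmax : maximalIdeal R = ⊥ := (IsLocalRing.isField_iff_maximalIdeal_eq).mp hfield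
  -- hence every non-zero element of `A` is a unit of `O`, and `R = K`
  have hval1 : ∀ a ∈ A, a ≠ 0 → O.valuation a = 1 := by
    intro a ha ha0
    have haR : a ∈ R := le_locAtCentre _ O ha
    by_contra hne
    have hlt : O.valuation a < 1 := lt_of_le_of_ne ((O.valuation_le_one_iff a).mpr (hRO haR)) hne
    have hmem : (⟨a, haR⟩ : R) ∈ maximalIdeal R := (mem_maximalIdeal_locAtCentre_iff hAO ⟨a, haR⟩).mpr hlt
    rw [hmax, Ideal.mem_bot] at hmem
    exact ha0 (congrArg Subtype.val hmem)
  haveI hfracI : IsFractionRing A K := hfrac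
  have hRtop : ∀ x : K, x ∈ R := by
    intro x
    obtain ⟨a, b, hb, hx⟩ := IsFractionRing.div_surjective (A := A) x
    have hx' : x = (a : K) / (b : K) := hx.symm
    rw [hx']
    by_cases ha0 : (a : K) = 0
    · rw [ha0, zero_div]; exact R.zero_mem
    · have hb0 : (b : K) ≠ 0 := fun h => nonZeroDivisors.ne_zero hb (Subtype.ext h)
      exact ⟨a, a.2, b, b.2, hval1 b b.2 hb0, rfl⟩
  -- the representative `g₀` itself (`c = (0, 1, 0, …, 0)`)
  have hg₀0 : g₀ ≠ 0 := fun h => hg₀ 0 (by rw [h, zero_pow hp.ne_zero])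
  refine ⟨A, hAO, le_rfl, hAfg, hreg, fun j : Fin p => if (j : ℕ) = 0 then 0 else if (j : ℕ) = 1 then 1 else 0,
    ⟨⟨1, hp.one_lt⟩, one_ne_zero, by simp⟩, Or.inr (Or.inl ⟨⟨g₀, hRtop g₀⟩, ?_, ?_, ?_⟩)⟩
  · -- `g₀` is a unit of the field `R`
    have hne : (⟨g₀, hRtop g₀⟩ : R) ∉ maximalIdeal R := by
      rw [hmax, Ideal.mem_bot]
      exact fun h => hg₀0 (congrArg Subtype.val h)
    by_contra hnu
    exact hne ((IsLocalRing.mem_maximalIdeal _).mpr (mem_nonunits_iff.mpr hnu))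
  · rw [Lens5.KbarCossart.sum_two_eq g₀ 0 1]
    simp [zero_pow hp.ne_zero]
  · intro c'
    rw [hmax, Ideal.mem_bot, sub_eq_zero]
    intro h
    have h' := congrArg Subtype.val h
    simp only [SubmonoidClass.coe_pow] at h'
    exact hg₀ (c' : K) h'.symm

/-! ## §2 Dimension `1`: the centre is a DVR -/

/-- **`hMono_1`** — local monomialization at a one-dimensional regular centre is free: the centre `R = A_{𝔪_O ∩ A}` is a DVR with uniformizer
`ϖ`, and every non-zero element of `A` is `unit × ϖⁿ` there (no blowing up: `A' = A`, `a = (ϖ)`). [folklore] -/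
theorem localMonomialization_one : ∀ (k : Type) [Field k] (K : Type) [Field K] [Algebra k K]
    (O : ValuationSubring K) (A : Subalgebra k K), A.toSubring ≤ O.toSubring → A.FG → IsFractionRing A K →
    ringKrullDim A ≤ (((1 : ℕ) : ℕ) : WithBot ℕ∞) → IsRegularLocalRing (locAtCentre A.toSubring O) →
    ringKrullDim (locAtCentre A.toSubring O) = (((1 : ℕ) : ℕ) : WithBot ℕ∞) →
    (∀ (T : Subring K) (hT : T ≤ O.toSubring), A.toSubring ≤ T → (subringCentre T O hT).IsMaximal) →
    ∀ Z : Finset K, (∀ z ∈ Z, z ∈ A) →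
    ∃ (A' : Subalgebra k K), A'.toSubring ≤ O.toSubring ∧ A ≤ A' ∧ A'.FG ∧
    ∃ (_ : IsRegularLocalRing (locAtCentre A'.toSubring O)) (e : ℕ) (a : Fin e → ↥(locAtCentre A'.toSubring O)),
      Ideal.span (Set.range a) = IsLocalRing.maximalIdeal ↥(locAtCentre A'.toSubring O) ∧
      ringKrullDim ↥(locAtCentre A'.toSubring O) = (e : WithBot ℕ∞) ∧
      ∀ z ∈ Z, z ≠ 0 → ∃ (v : ↥(locAtCentre A'.toSubring O)) (μ : Fin e → ℕ), IsUnit v ∧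
        z = (v : K) * ∏ i, ((a i : ↥(locAtCentre A'.toSubring O)) : K) ^ (μ i) := by
  intro k _ K _ _ O A hAO hAfg _hfrac _hdimA hreg hdim _hzd Z hZ
  classical
  haveI := hreg
  set R : Subring K := locAtCentre A.toSubring O with hRdef
  have hdim1 : ringKrullDim R = 1 := by rw [hdim, Nat.cast_one]
  haveI : IsDiscreteValuationRing R := isDiscreteValuationRing_of_isRegularLocalRing_of_ringKrullDim_eq_one R hdim1
  obtain ⟨ϖ, hϖ⟩ := IsDiscreteValuationRing.exists_irreducible R
  have hϖmax : maximalIdeal R = Ideal.span {ϖ} := (IsDiscreteValuationRing.irreducible_iff_uniformizer ϖ).mp hϖ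
  refine ⟨A, hAO, le_rfl, hAfg, hreg, 1, fun _ => ϖ, ?_, hdim, ?_⟩
  · rw [Set.range_const, hϖmax]
  · intro z hz hz0
    have hzR : z ∈ R := le_locAtCentre _ O (hZ z hz)
    have hz0' : (⟨z, hzR⟩ : R) ≠ 0 := fun h => hz0 (congrArg Subtype.val h)
    obtain ⟨n, u, hu⟩ := IsDiscreteValuationRing.eq_unit_mul_pow_irreducible hz0' hϖ
    refine ⟨(u : R), fun _ => n, u.isUnit, ?_⟩
    rw [Fin.prod_univ_one]
    have h := congrArg Subtype.val hu
    simpa using h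

/-- **A zero-dimensional valuation whose centre on a model is a one-dimensional regular local ring is DISCRETE OF RANK ONE** (in the skeleton's
sense: a value generator `π` with the archimedean property): the centre `R` is a DVR with `Frac R = K`, every `x ∈ K^×` is `w ϖⁿ/ϖᵐ` with `w` a
unit of `R`, and `O` dominates `R`. (In fact `O = R`.) [folklore] -/
theorem valuation_discrete_of_dimOne_centre {k : Type} [Field k] {K : Type} [Field K] [Algebra k K]
    (O : ValuationSubring K) (A : Subalgebra k K) (hAO : A.toSubring ≤ O.toSubring) (hfrac : IsFractionRing A K)
    (hreg : IsRegularLocalRing (locAtCentre A.toSubring O))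
    (hdim : ringKrullDim (locAtCentre A.toSubring O) = ((1 : ℕ) : WithBot ℕ∞)) :
    ∃ π : K, π ≠ 0 ∧ (∀ x : K, O.valuation x < 1 → O.valuation x ≤ O.valuation π) ∧
      (∀ x : K, x ≠ 0 → ∃ n : ℕ, O.valuation π ^ n ≤ O.valuation x) := by
  classical
  haveI := hreg
  set R : Subring K := locAtCentre A.toSubring O with hRdef
  have hdim1 : ringKrullDim R = 1 := by rw [hdim, Nat.cast_one]
  haveI : IsDiscreteValuationRing R := isDiscreteValuationRing_of_isRegularLocalRing_of_ringKrullDim_eq_one R hdim1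
  obtain ⟨ϖ, hϖ⟩ := IsDiscreteValuationRing.exists_irreducible R
  have hϖmax : maximalIdeal R = Ideal.span {ϖ} := (IsDiscreteValuationRing.irreducible_iff_uniformizer ϖ).mp hϖ
  -- units of `R` have value `1`, the uniformizer has value `< 1`
  have hvalU : ∀ u : Rˣ, O.valuation ((u : R) : K) = 1 := fun u =>
    (Ccurve.isUnit_locAtCentre_iff hAO (u : R)).mp u.isUnit
  have hϖlt : O.valuation (ϖ : K) < 1 :=
    (mem_maximalIdeal_locAtCentre_iff hAO ϖ).mp (by rw [hϖmax]; exact Ideal.mem_span_singleton_self ϖ)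
  have hϖle : O.valuation (ϖ : K) ≤ 1 := hϖlt.le
  have hϖ0 : (ϖ : K) ≠ 0 := fun h => hϖ.ne_zero (Subtype.ext h)
  have hvϖ0 : O.valuation (ϖ : K) ≠ 0 := (map_ne_zero O.valuation).mpr hϖ0
  haveI hfracI : IsFractionRing A K := hfrac
  -- the value of a non-zero `x ∈ K` is `v(ϖ)^d`, or `v(x) v(ϖ)^d = 1`
  have hfact : ∀ x : K, x ≠ 0 →
      (∃ d : ℕ, O.valuation x = O.valuation (ϖ : K) ^ d) ∨ (∃ d : ℕ, O.valuation x * O.valuation (ϖ : K) ^ d = 1) := by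
    intro x hx0
    obtain ⟨a, b, hb, hx⟩ := IsFractionRing.div_surjective (A := A) x
    have hx' : x = (a : K) / (b : K) := hx.symm
    have haR : (a : K) ∈ R := le_locAtCentre _ O a.2
    have hbR : (b : K) ∈ R := le_locAtCentre _ O b.2
    have hb0 : (b : K) ≠ 0 := fun h => nonZeroDivisors.ne_zero hb (Subtype.ext h)
    have ha0 : (a : K) ≠ 0 := by
      intro h; apply hx0; rw [hx', h, zero_div]
    obtain ⟨i, u₁, hu₁⟩ := IsDiscreteValuationRing.eq_unit_mul_pow_irreducible
      (show (⟨(a : K), haR⟩ : R) ≠ 0 from fun h => ha0 (congrArg Subtype.val h)) hϖ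
    obtain ⟨j, u₂, hu₂⟩ := IsDiscreteValuationRing.eq_unit_mul_pow_irreducible
      (show (⟨(b : K), hbR⟩ : R) ≠ 0 from fun h => hb0 (congrArg Subtype.val h)) hϖ
    have ha' : (a : K) = ((u₁ : R) : K) * (ϖ : K) ^ i := by simpa using congrArg Subtype.val hu₁
    have hb' : (b : K) = ((u₂ : R) : K) * (ϖ : K) ^ j := by simpa using congrArg Subtype.val hu₂
    have hkey : x * (((u₂ : R) : K) * (ϖ : K) ^ j) = ((u₁ : R) : K) * (ϖ : K) ^ i := by
      rw [hx', ha', hb']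
      exact div_mul_cancel₀ _ (mul_ne_zero (ne_zero_of_valuation_eq_one (hvalU u₂)) (pow_ne_zero _ hϖ0))
    have hval := congrArg O.valuation hkey
    simp only [map_mul, map_pow, hvalU, one_mul] at hval
    -- `hval : v x * v ϖ ^ j = v ϖ ^ i`
    rcases le_or_gt j i with hji | hij
    · left
      obtain ⟨d, rfl⟩ : ∃ d, i = j + d := ⟨i - j, by omega⟩
      refine ⟨d, mul_right_cancel₀ (pow_ne_zero j hvϖ0) ?_⟩
      rw [hval, pow_add, mul_comm]
    · right
      obtain ⟨d, rfl⟩ : ∃ d, j = i + d := ⟨j - i, by omega⟩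
      refine ⟨d, mul_right_cancel₀ (pow_ne_zero i hvϖ0) ?_⟩
      calc O.valuation x * O.valuation (ϖ : K) ^ d * O.valuation (ϖ : K) ^ i
          = O.valuation x * O.valuation (ϖ : K) ^ (i + d) := by
            rw [pow_add, mul_assoc, mul_comm (O.valuation (ϖ : K) ^ d)]
        _ = O.valuation (ϖ : K) ^ i := hval
        _ = 1 * O.valuation (ϖ : K) ^ i := (one_mul _).symm
  refine ⟨(ϖ : K), hϖ0, fun x hx => ?_, fun x hx0 => ?_⟩
  · by_cases hx0 : x = 0
    · rw [hx0, map_zero]; exact zero_le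
    rcases hfact x hx0 with ⟨d, hd⟩ | ⟨d, hd⟩
    · rw [hd]
      rcases Nat.eq_zero_or_pos d with h0 | hpos
      · exfalso
        rw [hd, h0, pow_zero] at hx
        exact lt_irrefl _ hx
      · calc O.valuation (ϖ : K) ^ d ≤ O.valuation (ϖ : K) ^ 1 := pow_le_pow_right_of_le_one' hϖle hpos
          _ = O.valuation (ϖ : K) := pow_one _
    · exfalso
      have h1 : O.valuation x * O.valuation (ϖ : K) ^ d < 1 :=
        lt_of_le_of_lt (mul_le_of_le_one_right' (pow_le_one' hϖle d)) hx
      rw [hd] at h1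
      exact lt_irrefl _ h1
  · rcases hfact x hx0 with ⟨d, hd⟩ | ⟨d, hd⟩
    · exact ⟨d, by rw [hd]⟩
    · refine ⟨0, ?_⟩
      rw [pow_zero]
      calc (1 : _) = O.valuation x * O.valuation (ϖ : K) ^ d := hd.symm
        _ ≤ O.valuation x := mul_le_of_le_one_right' (pow_le_one' hϖle d)

/-- **`CleanLUZeroDim_1`** — clean local uniformization at one-dimensional regular centres of zero-dimensional valuations, every `p`, every ground
field: ✓ `cleanLUZeroDim_dim_of_localMonomialization 1` with `hMono_1` = `localMonomialization_one` and the class-(B) input `hND_1` VACUOUS (its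
«not discrete of rank one» hypothesis contradicts `valuation_discrete_of_dimOne_centre`). [folklore] -/
theorem cleanLUZeroDim_one : ∀ (p : ℕ), p.Prime →
    ∀ (k : Type) [Field k] [CharP k p] (K : Type) [Field K] [Algebra k K]
    (O : ValuationSubring K) (A : Subalgebra k K), A.toSubring ≤ O.toSubring → A.FG → IsFractionRing A K →
    ringKrullDim A ≤ (((1 : ℕ) : ℕ) : WithBot ℕ∞) → IsRegularLocalRing (locAtCentre A.toSubring O) →
    ringKrullDim (locAtCentre A.toSubring O) = (((1 : ℕ) : ℕ) : WithBot ℕ∞) →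
    (∀ (T : Subring K) (hT : T ≤ O.toSubring), A.toSubring ≤ T → (subringCentre T O hT).IsMaximal) →
    ∀ g₀ : K, (∀ c : K, c ^ p ≠ g₀) →
    ∃ (A' : Subalgebra k K), A'.toSubring ≤ O.toSubring ∧ A ≤ A' ∧ A'.FG ∧
    ∃ (_ : IsRegularLocalRing (locAtCentre A'.toSubring O)) (c : Fin p → K), (∃ j : Fin p, (j : ℕ) ≠ 0 ∧ c j ≠ 0) ∧
    ((∃ (d m : ℕ) (hmd : m ≤ d) (t : Fin d → ↥(locAtCentre A'.toSubring O)) (a : Fin m → ℕ) (u : ↥(locAtCentre A'.toSubring O)), IsUnit u ∧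
    Ideal.span (Set.range t) = IsLocalRing.maximalIdeal ↥(locAtCentre A'.toSubring O) ∧
    ringKrullDim ↥(locAtCentre A'.toSubring O) = (d : WithBot ℕ∞) ∧ 0 < m ∧ (∀ i, ¬ p ∣ a i) ∧
    (∑ j : Fin p, c j ^ p * g₀ ^ (j : ℕ)) = (u : K) * ∏ i : Fin m, ((t (Fin.castLE hmd i) : ↥(locAtCentre A'.toSubring O)) : K) ^ (a i)) ∨
    (∃ u : ↥(locAtCentre A'.toSubring O), IsUnit u ∧ (∑ j : Fin p, c j ^ p * g₀ ^ (j : ℕ)) = (u : K) ∧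
    ∀ c' : ↥(locAtCentre A'.toSubring O), u - c' ^ p ∉ IsLocalRing.maximalIdeal ↥(locAtCentre A'.toSubring O)) ∨
    (∃ s c' : ↥(locAtCentre A'.toSubring O), (∑ j : Fin p, c j ^ p * g₀ ^ (j : ℕ)) = (s : K) ∧
    s - c' ^ p ∈ IsLocalRing.maximalIdeal ↥(locAtCentre A'.toSubring O) ∧
    s - c' ^ p ∉ IsLocalRing.maximalIdeal ↥(locAtCentre A'.toSubring O) ^ 2)) := by
  intro p hp k _ _ K _ _ O A hAO hAfg hfrac hdimA hreg hdim hzd g₀ hg₀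
  refine cleanLUZeroDim_dim_of_localMonomialization 1 localMonomialization_one ?_ p hp k K O A hAO hAfg hfrac hdimA hreg hdim hzd g₀ hg₀
  intro p' _ k' _ _ K' _ _ O' A' hA'O' _ hfrac' _ hreg' hdim' _ g' _ _ _ hdisc
  exact absurd (valuation_discrete_of_dimOne_centre O' A' hA'O' hfrac' hreg' hdim') hdisc

/-! ## §3 Dimension `2`: the landed stub D2 -/

/-- **`CleanLUZeroDim_2`** — VERBATIM the landed ✓ `stub_cleanLU2` (clean local uniformization in dimension two from F-75c ✓ `stub_stacks0BICLocus`;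
lead res-B-lead-1 g5), with the (unused) hypothesis `dim A ≤ 2` of the graded shape. [cite: Giraud1983, Thm. 2.4] [cite: StacksProject, Tag 0BIC] -/
theorem cleanLUZeroDim_two : ∀ (p : ℕ), p.Prime →
    ∀ (k : Type) [Field k] [CharP k p] (K : Type) [Field K] [Algebra k K]
    (O : ValuationSubring K) (A : Subalgebra k K), A.toSubring ≤ O.toSubring → A.FG → IsFractionRing A K →
    ringKrullDim A ≤ (((2 : ℕ) : ℕ) : WithBot ℕ∞) → IsRegularLocalRing (locAtCentre A.toSubring O) →
    ringKrullDim (locAtCentre A.toSubring O) = (((2 : ℕ) : ℕ) : WithBot ℕ∞) →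
    (∀ (T : Subring K) (hT : T ≤ O.toSubring), A.toSubring ≤ T → (subringCentre T O hT).IsMaximal) →
    ∀ g₀ : K, (∀ c : K, c ^ p ≠ g₀) →
    ∃ (A' : Subalgebra k K), A'.toSubring ≤ O.toSubring ∧ A ≤ A' ∧ A'.FG ∧
    ∃ (_ : IsRegularLocalRing (locAtCentre A'.toSubring O)) (c : Fin p → K), (∃ j : Fin p, (j : ℕ) ≠ 0 ∧ c j ≠ 0) ∧
    ((∃ (d m : ℕ) (hmd : m ≤ d) (t : Fin d → ↥(locAtCentre A'.toSubring O)) (a : Fin m → ℕ) (u : ↥(locAtCentre A'.toSubring O)), IsUnit u ∧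
    Ideal.span (Set.range t) = IsLocalRing.maximalIdeal ↥(locAtCentre A'.toSubring O) ∧
    ringKrullDim ↥(locAtCentre A'.toSubring O) = (d : WithBot ℕ∞) ∧ 0 < m ∧ (∀ i, ¬ p ∣ a i) ∧
    (∑ j : Fin p, c j ^ p * g₀ ^ (j : ℕ)) = (u : K) * ∏ i : Fin m, ((t (Fin.castLE hmd i) : ↥(locAtCentre A'.toSubring O)) : K) ^ (a i)) ∨
    (∃ u : ↥(locAtCentre A'.toSubring O), IsUnit u ∧ (∑ j : Fin p, c j ^ p * g₀ ^ (j : ℕ)) = (u : K) ∧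
    ∀ c' : ↥(locAtCentre A'.toSubring O), u - c' ^ p ∉ IsLocalRing.maximalIdeal ↥(locAtCentre A'.toSubring O)) ∨
    (∃ s c' : ↥(locAtCentre A'.toSubring O), (∑ j : Fin p, c j ^ p * g₀ ^ (j : ℕ)) = (s : K) ∧
    s - c' ^ p ∈ IsLocalRing.maximalIdeal ↥(locAtCentre A'.toSubring O) ∧
    s - c' ^ p ∉ IsLocalRing.maximalIdeal ↥(locAtCentre A'.toSubring O) ^ 2)) := by
  intro p hp k _ _ K _ _ O A hAO hAfg hfrac _hdimA hreg hdim hzd g₀ hg₀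
  have hdim2 : ringKrullDim (locAtCentre A.toSubring O) = 2 := by rw [hdim, Nat.cast_ofNat]
  exact stub_cleanLU2 p hp k K O A hAO hAfg hfrac hreg hdim2 hzd g₀ hg₀

end Summit.ResolutionOfSingularities.ResolutionOfSingularities.Theorems.RadicialJung.CleanModels

end
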